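import Literature.Probability.RandomPlanarGeometry.RectangleSCIntegrand
import HarnessLib

/-!
# The Schwarz–Christoffel map of the rectangle, II: the vertex `1` and the right side

Second input of the proof of `rectangle_crossRatio_eq_elliptic` (Bollobás–Riordan (2006), Ch. 7
§7.1, p. 185), continuing `RectangleSCIntegrand.lean` (`F_k = scrFun k`, `F_k′ = f_k = scrDeriv k`
on the doubly slit plane `scrDomain`, `F_k = ellipticF (k²)` on `(-1, 1)`). Here `0 < k < 1`.

Near the prevertex `1` the integrand `f_k(t) = (1-t²)^{-1/2}(1-k²t²)^{-1/2}` factors as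
`(1-t)^{-1/2} g_k(t)` with `g_k(t) = (1+t)^{-1/2}(1-k²t²)^{-1/2}` (`scrVtxFactor`) holomorphic on
`ℂ \ ((-∞,-1] ∪ [1/k,∞))` (`scrVtxDomain`), a star domain about `1`. Substituting `t = 1 - (1-w)u`
in `∫_w^1 f_k` gives the **vertex representation**

`G_k(w) = (1-w)^{1/2} h₁(w)`, `h₁(w) = ∫₀¹ u^{-1/2} g_k(1 - (1-w)u) du` (`scrG`, `scrVtxAux`),

with `h₁` holomorphic on `scrVtxDomain` (differentiation under the integral sign) and
`G_k′ = -(1-w)^{-1/2} g_k(w) = -f_k(w)` on `scrDomain` (integration by parts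
`h₁ - 2(1-w)h₁′ = 2 g_k`, and the branch identity `(1-w²)^{-1/2} = (1-w)^{-1/2}(1+w)^{-1/2}` on the
doubly slit plane, `one_sub_sq_cpow_neg_half`). Hence

* `scrFun_add_scrG`: `F_k + G_k ≡ K(k²) = ellipticK (k²)` on `scrDomain` (zero derivative on a
  preconnected open set; value at `0`, where `h₁(0) = ∫₀¹ u^{-1/2} g_k(1-u) du = K(k²)`);
* `tendsto_scrFun_one`: **the boundary value at the prevertex `1` is the corner `K(k²)`**
  (`(1-w)^{1/2} → 0`, `h₁` continuous at `1`);
* `tendsto_scrFun_of_mem_Ioo_one_inv`: for `x ∈ (1, 1/k)` the boundary value at `x` is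
  `K(k²) + i V_k(x)` with `V_k(x) = √(x-1) h₁(x) ≥ 0` real (`scrV`): as `w → x` inside `ℍₒ`,
  `1 - w → 1 - x < 0` from the lower half-plane, so `(1-w)^{1/2} → -i√(x-1)`
  (`Complex.tendsto_log_nhdsWithin_im_neg_of_re_neg_of_im_zero`). These are the points of the
  right side `re = K(k²)` of the rectangle.

## References

* B. Bollobás, O. Riordan, *Percolation*, CUP (2006), Ch. 7 §7.1, p. 185.
* L. V. Ahlfors, *Complex Analysis*, 3rd ed. (1979), Ch. 6 §2.2 (behaviour of the
  Schwarz–Christoffel integral at the prevertices, `F(w) = F(wₖ) + (w - wₖ)^{αₖ} G(w)`), §2.3.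
* Z. Nehari, *Conformal Mapping*, McGraw-Hill (1952), Ch. V §6.
-/

open Set Filter Topology Complex MeasureTheory Metric
open scoped Real Interval ComplexConjugate
open UpperHalfPlane (upperHalfPlaneSet isOpen_upperHalfPlaneSet)

noncomputable section

namespace Literature.Probability.RandomPlanarGeometry

variable {k : ℝ}

/-! ### The star domain `ℂ \ ((-∞,-1] ∪ [1/k,∞))` about the prevertex `1` -/

/-- The slit plane `ℂ \ ((-∞, -1] ∪ [1/k, ∞))`, domain of holomorphy of the vertex factor
`g_k(t) = (1+t)^{-1/2}(1-k²t²)^{-1/2}`; for `0 < k < 1` it is a star domain about `1`. [folklore] -/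
def scrVtxDomain (k : ℝ) : Set ℂ := {t : ℂ | t.im ≠ 0 ∨ (-1 < t.re ∧ t.re < k⁻¹)}

/-- `ℂ \ ((-∞,-1] ∪ [1/k,∞))` is open. [folklore] -/
theorem isOpen_scrVtxDomain (k : ℝ) : IsOpen (scrVtxDomain k) :=
  (isOpen_ne_fun continuous_im continuous_const).union
    ((isOpen_lt continuous_const continuous_re).inter (isOpen_lt continuous_re continuous_const))

/-- `1 ∈ ℂ \ ((-∞,-1] ∪ [1/k,∞))` for `0 < k < 1`. [folklore] -/
theorem one_mem_scrVtxDomain (hk0 : 0 < k) (hk1 : k < 1) : (1 : ℂ) ∈ scrVtxDomain k :=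
  Or.inr ⟨by simp, by simpa using one_lt_inv_iff₀.2 ⟨hk0, hk1⟩⟩

/-- The doubly slit plane is contained in `ℂ \ ((-∞,-1] ∪ [1/k,∞))` (`0 < k < 1`). [folklore] -/
theorem scrDomain_subset_scrVtxDomain (hk0 : 0 < k) (hk1 : k < 1) : scrDomain ⊆ scrVtxDomain k := by
  rintro t (h | ⟨h1, h2⟩)
  · exact Or.inl h
  · exact Or.inr ⟨h1, h2.trans (one_lt_inv_iff₀.2 ⟨hk0, hk1⟩)⟩

/-- Real points of `(-1, 1/k)` lie in `ℂ \ ((-∞,-1] ∪ [1/k,∞))`. [folklore] -/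
theorem ofReal_mem_scrVtxDomain {x : ℝ} (hx : x ∈ Ioo (-1 : ℝ) k⁻¹) : (x : ℂ) ∈ scrVtxDomain k :=
  Or.inr (by simpa using hx)

/-- **Star-shapedness about `1`**: the segment from `1` to a point `w` of `ℂ \ ((-∞,-1] ∪ [1/k,∞))`
stays inside: `1 - (1 - w)u ∈ scrVtxDomain k` for `u ∈ [0, 1]` (`0 < k < 1`). [folklore] -/
theorem segment_mem_scrVtxDomain (hk0 : 0 < k) (hk1 : k < 1) {w : ℂ} (hw : w ∈ scrVtxDomain k) {u : ℝ}
    (hu : u ∈ Icc (0 : ℝ) 1) : 1 - (1 - w) * (u : ℂ) ∈ scrVtxDomain k := by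
  have hk : (1 : ℝ) < k⁻¹ := one_lt_inv_iff₀.2 ⟨hk0, hk1⟩
  rcases eq_or_lt_of_le hu.1 with rfl | hu0
  · simpa using one_mem_scrVtxDomain hk0 hk1
  simp only [scrVtxDomain, mem_setOf_eq, sub_im, one_im, mul_im, sub_re, one_re, ofReal_re,
    ofReal_im, mul_zero, zero_sub, ne_eq, mul_re, sub_zero]
  rcases hw with h | ⟨h1, h2⟩
  · left
    intro h'
    apply h
    have : w.im * u = 0 := by linarith
    exact (mul_eq_zero.1 this).resolve_right hu0.ne'
  · right
    constructor <;> nlinarith [hu.2]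

/-- For `t ∈ ℂ \ ((-∞,-1] ∪ [1/k,∞))`, `1 + t` lies in the slit plane `ℂ \ (-∞, 0]`. [folklore] -/
theorem one_add_mem_slitPlane_of_mem {t : ℂ} (ht : t ∈ scrVtxDomain k) : 1 + t ∈ slitPlane := by
  rw [mem_slitPlane_iff]
  rcases ht with h | ⟨h1, -⟩
  · exact Or.inr (by simpa using h)
  · exact Or.inl (by simp; linarith)

/-- For `t ∈ ℂ \ ((-∞,-1] ∪ [1/k,∞))` and `0 < k < 1`, `k t` lies in the doubly slit plane (so
`1 - k²t²` lies in the slit plane). [folklore] -/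
theorem mul_mem_scrDomain_of_mem (hk0 : 0 < k) (hk1 : k < 1) {t : ℂ} (ht : t ∈ scrVtxDomain k) :
    (k : ℂ) * t ∈ scrDomain := by
  simp only [scrDomain, mem_setOf_eq, mul_im, ofReal_re, ofReal_im, zero_mul, add_zero, mul_re,
    sub_zero, ne_eq, mul_eq_zero, not_or]
  rcases ht with h | ⟨h1, h2⟩
  · exact Or.inl ⟨hk0.ne', h⟩
  · right
    constructor
    · nlinarith
    · have := mul_lt_mul_of_pos_left h2 hk0
      rwa [mul_inv_cancel₀ hk0.ne'] at this

/-- Points near a point of the open set `ℂ \ ((-∞,-1] ∪ [1/k,∞))`: a closed ball inside it. [folklore] -/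
theorem exists_closedBall_subset_scrVtxDomain {w₀ : ℂ} (hw₀ : w₀ ∈ scrVtxDomain k) :
    ∃ ε > 0, closedBall w₀ ε ⊆ scrVtxDomain k := by
  obtain ⟨ε, hε, h⟩ := Metric.isOpen_iff.1 (isOpen_scrVtxDomain k) w₀ hw₀
  exact ⟨ε / 2, half_pos hε, closedBall_subset_ball (half_lt_self hε) |>.trans h⟩

/-! ### The vertex factor `g_k(t) = (1+t)^{-1/2} (1-k²t²)^{-1/2}` -/

/-- The **vertex factor** `g_k(t) = (1 + t)^{-1/2} (1 - (k t)²)^{-1/2}` (principal powers), the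
regular part of the integrand `f_k(t) = (1-t)^{-1/2} g_k(t)` at the prevertex `1`
(Ahlfors (1979), Ch. 6 §2.2). [cite: AhlforsCA1979, Ch. 6 §2.2] -/
def scrVtxFactor (k : ℝ) (t : ℂ) : ℂ :=
  (1 + t) ^ (-(1 / 2 : ℂ)) * (1 - ((k : ℂ) * t) ^ 2) ^ (-(1 / 2 : ℂ))

/-- `g_k` is holomorphic at each point of `ℂ \ ((-∞,-1] ∪ [1/k,∞))`. [folklore] -/
theorem differentiableAt_scrVtxFactor (hk0 : 0 < k) (hk1 : k < 1) {t : ℂ} (ht : t ∈ scrVtxDomain k) :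
    DifferentiableAt ℂ (scrVtxFactor k) t := by
  unfold scrVtxFactor
  refine DifferentiableAt.mul ?_ ?_
  · exact ((differentiableAt_const _).add differentiableAt_id).cpow (differentiableAt_const _)
      (one_add_mem_slitPlane_of_mem ht)
  · exact ((differentiableAt_const _).sub ((differentiableAt_id.const_mul _).pow 2)).cpow
      (differentiableAt_const _) (one_sub_sq_mem_slitPlane (mul_mem_scrDomain_of_mem hk0 hk1 ht))

/-- `g_k` is holomorphic on `ℂ \ ((-∞,-1] ∪ [1/k,∞))`. [folklore] -/
theorem differentiableOn_scrVtxFactor (hk0 : 0 < k) (hk1 : k < 1) :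
    DifferentiableOn ℂ (scrVtxFactor k) (scrVtxDomain k) := fun _ ht =>
  (differentiableAt_scrVtxFactor hk0 hk1 ht).differentiableWithinAt

/-- `g_k` is continuous on `ℂ \ ((-∞,-1] ∪ [1/k,∞))`. [folklore] -/
theorem continuousOn_scrVtxFactor (hk0 : 0 < k) (hk1 : k < 1) :
    ContinuousOn (scrVtxFactor k) (scrVtxDomain k) :=
  (differentiableOn_scrVtxFactor hk0 hk1).continuousOn

/-- `g_k′` is continuous on `ℂ \ ((-∞,-1] ∪ [1/k,∞))`. [folklore] -/
theorem continuousOn_deriv_scrVtxFactor (hk0 : 0 < k) (hk1 : k < 1) :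
    ContinuousOn (deriv (scrVtxFactor k)) (scrVtxDomain k) :=
  ((differentiableOn_scrVtxFactor hk0 hk1).contDiffOn (n := 1) (isOpen_scrVtxDomain k)).continuousOn_deriv_of_isOpen
    (isOpen_scrVtxDomain k) le_rfl

/-- **The branch identity on the doubly slit plane**:
`(1 - w²)^{-1/2} = (1 - w)^{-1/2} (1 + w)^{-1/2}` for `w ∈ scrDomain` (principal powers;
`arg (1-w) + arg (1+w) ∈ (-π, π]` because `1 - w` and `1 + w` have imaginary parts of opposite
signs). [folklore] -/
theorem one_sub_sq_cpow_neg_half {w : ℂ} (hw : w ∈ scrDomain) :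
    (1 - w ^ 2) ^ (-(1 / 2 : ℂ)) = (1 - w) ^ (-(1 / 2 : ℂ)) * (1 + w) ^ (-(1 / 2 : ℂ)) := by
  have hne : 1 - w ≠ 0 ∧ 1 + w ≠ 0 := by
    constructor
    · intro h
      have : w = 1 := by linear_combination -h
      rcases hw with h' | h' <;> simp [this] at h'
    · intro h
      have : w = -1 := by linear_combination h
      rcases hw with h' | h' <;> simp [this] at h'
  have harg : arg (1 - w) + arg (1 + w) ∈ Ioc (-π) π := by
    have a1 := neg_pi_lt_arg (1 - w)
    have a2 := neg_pi_lt_arg (1 + w)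
    have b1 := arg_le_pi (1 - w)
    have b2 := arg_le_pi (1 + w)
    rcases lt_trichotomy w.im 0 with him | him | him
    · -- `1 + w` in the lower half-plane, `1 - w` in the upper
      have h1 : arg (1 + w) < 0 := arg_neg_iff.2 (by simpa using him)
      have h2 : 0 ≤ arg (1 - w) := arg_nonneg_iff.2 (by simp; linarith)
      exact ⟨by linarith, by linarith⟩
    · have hre : -1 < w.re ∧ w.re < 1 := by
        rcases hw with h | h
        · exact absurd him h
        · exact h
      have h1 : arg (1 - w) = 0 := arg_eq_zero_iff.2 ⟨by simp; linarith [hre.2], by simp [him]⟩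
      have h2 : arg (1 + w) = 0 := arg_eq_zero_iff.2 ⟨by simp; linarith [hre.1], by simp [him]⟩
      rw [h1, h2, add_zero]
      exact ⟨by linarith [Real.pi_pos], Real.pi_pos.le⟩
    · have h1 : arg (1 - w) < 0 := arg_neg_iff.2 (by simpa using him)
      have h2 : 0 ≤ arg (1 + w) := arg_nonneg_iff.2 (by simp; linarith)
      exact ⟨by linarith, by linarith⟩
  rw [show (1 : ℂ) - w ^ 2 = (1 - w) * (1 + w) by ring]
  exact mul_cpow_of_arg hne.1 hne.2 harg _

/-- For `w` in the doubly slit plane, `1 - w` lies in the slit plane. [folklore] -/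
theorem one_sub_mem_slitPlane_of_mem_scrDomain {w : ℂ} (hw : w ∈ scrDomain) : 1 - w ∈ slitPlane := by
  rw [mem_slitPlane_iff]
  rcases hw with h | ⟨-, h2⟩
  · exact Or.inr (by simpa using h)
  · exact Or.inl (by simp; linarith)

/-- **Factorisation of the integrand at the prevertex `1`**: `f_k(w) = (1 - w)^{-1/2} g_k(w)` on the
doubly slit plane. [folklore] -/
theorem scrDeriv_eq_cpow_mul_scrVtxFactor {w : ℂ} (hw : w ∈ scrDomain) :
    scrDeriv k w = (1 - w) ^ (-(1 / 2 : ℂ)) * scrVtxFactor k w := by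
  rw [scrDeriv, one_sub_sq_cpow_neg_half hw, scrVtxFactor, mul_assoc]

/-- **Real values of the vertex factor**: for real `t ∈ (-1, 1/k)` (`0 < k < 1`),
`g_k(t) = (1+t)^{-1/2} (1-(kt)²)^{-1/2}` with real powers of positive numbers. [folklore] -/
theorem scrVtxFactor_ofReal (hk0 : 0 < k) (hk1 : k < 1) {t : ℝ} (ht : t ∈ Ioo (-1 : ℝ) k⁻¹) :
    scrVtxFactor k t = (((1 + t) ^ (-(1 / 2 : ℝ)) * (1 - (k * t) ^ 2) ^ (-(1 / 2 : ℝ)) : ℝ) : ℂ) := by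
  have h1 : 0 ≤ 1 + t := by linarith [ht.1]
  have hkt : k * t ∈ Ioo (-1 : ℝ) 1 :=
    mem_Ioo_of_ofReal_mem_scrDomain (by
      simpa using mul_mem_scrDomain_of_mem hk0 hk1 (ofReal_mem_scrVtxDomain ht))
  have h2 : 0 ≤ 1 - (k * t) ^ 2 := (one_sub_sq_pos_of_mem_Ioo hkt).le
  rw [scrVtxFactor, neg_half_eq_cast,
    show (1 : ℂ) + (t : ℂ) = ((1 + t : ℝ) : ℂ) by push_cast; ring,
    show (1 : ℂ) - ((k : ℂ) * t) ^ 2 = ((1 - (k * t) ^ 2 : ℝ) : ℂ) by push_cast; ring,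
    ← ofReal_cpow h1, ← ofReal_cpow h2, ← ofReal_mul]

/-- The vertex factor is real and positive on `(-1, 1/k)`. [folklore] -/
theorem scrVtxFactor_ofReal_pos (hk0 : 0 < k) (hk1 : k < 1) {t : ℝ} (ht : t ∈ Ioo (-1 : ℝ) k⁻¹) :
    0 < (1 + t) ^ (-(1 / 2 : ℝ)) * (1 - (k * t) ^ 2) ^ (-(1 / 2 : ℝ)) := by
  have h1 : 0 < 1 + t := by linarith [ht.1]
  have hkt : k * t ∈ Ioo (-1 : ℝ) 1 :=
    mem_Ioo_of_ofReal_mem_scrDomain (by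
      simpa using mul_mem_scrDomain_of_mem hk0 hk1 (ofReal_mem_scrVtxDomain ht))
  have h2 : 0 < 1 - (k * t) ^ 2 := one_sub_sq_pos_of_mem_Ioo hkt
  exact mul_pos (Real.rpow_pos_of_pos h1 _) (Real.rpow_pos_of_pos h2 _)

/-! ### The kernel `u^{-1/2} g_k(1 - (1-w)u)` and the factor `h₁(w)` -/

/-- The kernel `u^{-1/2} g_k(1 - (1 - w)u)` of `h₁(w) = ∫₀¹ u^{-1/2} g_k(1 - (1-w)u) du`. [folklore] -/
def scrVtxKernel (k : ℝ) (w : ℂ) (u : ℝ) : ℂ :=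
  ((u ^ (-(1 / 2 : ℝ)) : ℝ) : ℂ) * scrVtxFactor k (1 - (1 - w) * (u : ℂ))

/-- The `w`-derivative `u^{1/2} g_k′(1 - (1 - w)u)` of the kernel. [folklore] -/
def scrVtxKernelDeriv (k : ℝ) (w : ℂ) (u : ℝ) : ℂ :=
  ((u ^ (1 / 2 : ℝ) : ℝ) : ℂ) * deriv (scrVtxFactor k) (1 - (1 - w) * (u : ℂ))

/-- The factor `h₁(w) = ∫₀¹ u^{-1/2} g_k(1 - (1-w)u) du` of the vertex representation. [folklore] -/
def scrVtxAux (k : ℝ) (w : ℂ) : ℂ := ∫ u in (0 : ℝ)..1, scrVtxKernel k w u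

/-- **The vertex representation** `G_k(w) = (1 - w)^{1/2} h₁(w)` (`= ∫_w^1 f_k`, substituting
`t = 1 - (1-w)u`; principal branch of `(1-w)^{1/2}`). On the doubly slit plane
`F_k + G_k ≡ K(k²)` (`scrFun_add_scrG`). Ahlfors (1979), Ch. 6 §2.2. [cite: AhlforsCA1979, Ch. 6 §2.2] -/
def scrG (k : ℝ) (w : ℂ) : ℂ := (1 - w) ^ (1 / 2 : ℂ) * scrVtxAux k w

/-- The kernel is holomorphic in `w` with derivative `scrVtxKernelDeriv` (`u ∈ (0, 1]`). [folklore] -/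
theorem hasDerivAt_scrVtxKernel (hk0 : 0 < k) (hk1 : k < 1) {w : ℂ} (hw : w ∈ scrVtxDomain k) {u : ℝ}
    (hu : u ∈ Ioc (0 : ℝ) 1) :
    HasDerivAt (fun w => scrVtxKernel k w u) (scrVtxKernelDeriv k w u) w := by
  have hseg := segment_mem_scrVtxDomain hk0 hk1 hw ⟨hu.1.le, hu.2⟩
  have hin : HasDerivAt (fun w : ℂ => 1 - (1 - w) * (u : ℂ)) (u : ℂ) w := by
    have h := ((hasDerivAt_id w).const_sub 1).mul_const (u : ℂ)
    have h' := h.const_sub (1 : ℂ)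
    simpa using h'
  have h := ((differentiableAt_scrVtxFactor hk0 hk1 hseg).hasDerivAt.comp w hin).const_mul
    (((u ^ (-(1 / 2 : ℝ)) : ℝ) : ℂ))
  have hfun : (fun w => scrVtxKernel k w u) =
      fun w => (((u ^ (-(1 / 2 : ℝ)) : ℝ) : ℂ)) * scrVtxFactor k (1 - (1 - w) * (u : ℂ)) := rfl
  rw [hfun]
  refine h.congr_deriv ?_
  rw [scrVtxKernelDeriv]
  have hpow : ((u ^ (-(1 / 2 : ℝ)) : ℝ) : ℂ) * (u : ℂ) = ((u ^ (1 / 2 : ℝ) : ℝ) : ℂ) := by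
    rw [← ofReal_mul]
    congr 1
    rw [show u ^ (1 / 2 : ℝ) = u ^ (-(1 / 2 : ℝ) + 1) by norm_num, Real.rpow_add_one hu.1.ne']
  rw [← hpow]
  ring

/-- The kernel is continuous in `u ∈ (0, 1]`. [folklore] -/
theorem continuousOn_scrVtxKernel (hk0 : 0 < k) (hk1 : k < 1) {w : ℂ} (hw : w ∈ scrVtxDomain k) :
    ContinuousOn (scrVtxKernel k w) (Ioc 0 1) := by
  intro u hu
  refine ContinuousAt.continuousWithinAt ?_
  unfold scrVtxKernel
  refine ContinuousAt.mul ?_ ?_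
  · exact Complex.continuous_ofReal.continuousAt.comp (Real.continuousAt_rpow_const _ _ (Or.inl hu.1.ne'))
  · exact ContinuousAt.comp (f := fun u : ℝ => 1 - (1 - w) * (u : ℂ))
      ((continuousOn_scrVtxFactor hk0 hk1).continuousAt ((isOpen_scrVtxDomain k).mem_nhds
        (segment_mem_scrVtxDomain hk0 hk1 hw ⟨hu.1.le, hu.2⟩))) (by fun_prop)

/-- The `w`-derivative of the kernel is continuous in `u ∈ (0, 1]`. [folklore] -/
theorem continuousOn_scrVtxKernelDeriv (hk0 : 0 < k) (hk1 : k < 1) {w : ℂ} (hw : w ∈ scrVtxDomain k) :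
    ContinuousOn (scrVtxKernelDeriv k w) (Ioc 0 1) := by
  intro u hu
  refine ContinuousAt.continuousWithinAt ?_
  unfold scrVtxKernelDeriv
  refine ContinuousAt.mul ?_ ?_
  · exact Complex.continuous_ofReal.continuousAt.comp (Real.continuousAt_rpow_const _ _ (Or.inl hu.1.ne'))
  · exact ContinuousAt.comp (f := fun u : ℝ => 1 - (1 - w) * (u : ℂ))
      ((continuousOn_deriv_scrVtxFactor hk0 hk1).continuousAt ((isOpen_scrVtxDomain k).mem_nhds
        (segment_mem_scrVtxDomain hk0 hk1 hw ⟨hu.1.le, hu.2⟩))) (by fun_prop)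

/-- The kernel is measurable in `u` on `(0, 1]`. [folklore] -/
theorem aestronglyMeasurable_scrVtxKernel (hk0 : 0 < k) (hk1 : k < 1) {w : ℂ} (hw : w ∈ scrVtxDomain k) :
    AEStronglyMeasurable (scrVtxKernel k w) (volume.restrict (Ι (0 : ℝ) 1)) := by
  rw [uIoc_of_le zero_le_one]
  exact (continuousOn_scrVtxKernel hk0 hk1 hw).aestronglyMeasurable measurableSet_Ioc

/-- The `w`-derivative of the kernel is measurable in `u` on `(0, 1]`. [folklore] -/
theorem aestronglyMeasurable_scrVtxKernelDeriv (hk0 : 0 < k) (hk1 : k < 1) {w : ℂ}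
    (hw : w ∈ scrVtxDomain k) :
    AEStronglyMeasurable (scrVtxKernelDeriv k w) (volume.restrict (Ι (0 : ℝ) 1)) := by
  rw [uIoc_of_le zero_le_one]
  exact (continuousOn_scrVtxKernelDeriv hk0 hk1 hw).aestronglyMeasurable measurableSet_Ioc

/-- **Local uniform bounds**: near a point of `ℂ \ ((-∞,-1] ∪ [1/k,∞))`, `‖g_k‖` and `‖g_k′‖` are
bounded on the segments `1 - (1-w)u`, `u ∈ [0,1]` (continuity on a compact set), so the kernel is
`O(u^{-1/2})` and its `w`-derivative is `O(1)`, uniformly in `w`. [folklore] -/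
theorem exists_bound_scrVtxKernel (hk0 : 0 < k) (hk1 : k < 1) {w₀ : ℂ} (hw₀ : w₀ ∈ scrVtxDomain k) :
    ∃ ε > 0, closedBall w₀ ε ⊆ scrVtxDomain k ∧ ∃ C, 0 ≤ C ∧ ∀ w ∈ closedBall w₀ ε, ∀ u ∈ Ioc (0 : ℝ) 1,
      ‖scrVtxKernel k w u‖ ≤ C * u ^ (-(1 / 2 : ℝ)) ∧ ‖scrVtxKernelDeriv k w u‖ ≤ C := by
  obtain ⟨ε, hε, hball⟩ := exists_closedBall_subset_scrVtxDomain hw₀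
  set S : Set ℂ := (fun p : ℝ × ℂ => 1 - (1 - p.2) * (p.1 : ℂ)) '' (Icc (0 : ℝ) 1 ×ˢ closedBall w₀ ε)
    with hS
  have hSc : IsCompact S := (isCompact_Icc.prod (isCompact_closedBall w₀ ε)).image (by fun_prop)
  have hSsub : S ⊆ scrVtxDomain k := by
    rintro _ ⟨⟨u, w⟩, ⟨hu, hw⟩, rfl⟩
    exact segment_mem_scrVtxDomain hk0 hk1 (hball hw) hu
  obtain ⟨C₀, hC₀⟩ := hSc.exists_bound_of_continuousOn ((continuousOn_scrVtxFactor hk0 hk1).mono hSsub)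
  obtain ⟨C₁, hC₁⟩ := hSc.exists_bound_of_continuousOn ((continuousOn_deriv_scrVtxFactor hk0 hk1).mono hSsub)
  refine ⟨ε, hε, hball, max (max C₀ C₁) 0, le_max_right _ _, fun w hw u hu => ?_⟩
  have hmem : 1 - (1 - w) * (u : ℂ) ∈ S := ⟨⟨u, w⟩, ⟨⟨hu.1.le, hu.2⟩, hw⟩, rfl⟩
  have hC : 0 ≤ max (max C₀ C₁) 0 := le_max_right _ _
  constructor
  · rw [scrVtxKernel, norm_mul, Complex.norm_real, Real.norm_of_nonneg (Real.rpow_nonneg hu.1.le _), mul_comm]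
    exact mul_le_mul_of_nonneg_right ((hC₀ _ hmem).trans ((le_max_left _ _).trans (le_max_left _ _)))
      (Real.rpow_nonneg hu.1.le _)
  · rw [scrVtxKernelDeriv, norm_mul, Complex.norm_real, Real.norm_of_nonneg (Real.rpow_nonneg hu.1.le _)]
    have hu1 : u ^ (1 / 2 : ℝ) ≤ 1 := Real.rpow_le_one hu.1.le hu.2 (by norm_num)
    calc u ^ (1 / 2 : ℝ) * ‖deriv (scrVtxFactor k) (1 - (1 - w) * (u : ℂ))‖
        ≤ 1 * max (max C₀ C₁) 0 := mul_le_mul hu1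
          ((hC₁ _ hmem).trans ((le_max_right _ _).trans (le_max_left _ _))) (norm_nonneg _) zero_le_one
      _ = _ := one_mul _

/-- `u ↦ C u^{-1/2}` is integrable on `[0, 1]`. [folklore] -/
theorem intervalIntegrable_const_mul_rpow_neg_half (C : ℝ) :
    IntervalIntegrable (fun u : ℝ => C * u ^ (-(1 / 2 : ℝ))) volume 0 1 :=
  (intervalIntegral.intervalIntegrable_rpow' (by norm_num)).const_mul C

/-- The kernel is integrable in `u ∈ [0, 1]` (it is `O(u^{-1/2})`). [folklore] -/
theorem intervalIntegrable_scrVtxKernel (hk0 : 0 < k) (hk1 : k < 1) {w : ℂ} (hw : w ∈ scrVtxDomain k) :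
    IntervalIntegrable (scrVtxKernel k w) volume 0 1 := by
  obtain ⟨ε, hε, -, C, -, hC⟩ := exists_bound_scrVtxKernel hk0 hk1 hw
  refine (intervalIntegrable_const_mul_rpow_neg_half C).mono_fun' (aestronglyMeasurable_scrVtxKernel hk0 hk1 hw) ?_
  rw [uIoc_of_le zero_le_one]
  refine (ae_restrict_iff' measurableSet_Ioc).2 (Eventually.of_forall fun u hu => ?_)
  exact (hC w (mem_closedBall_self hε.le) u hu).1

/-- **Holomorphy of `h₁`.** `h₁(w) = ∫₀¹ u^{-1/2} g_k(1 - (1-w)u) du` is complex differentiable on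
`ℂ \ ((-∞,-1] ∪ [1/k,∞))` with `h₁′(w) = ∫₀¹ u^{1/2} g_k′(1 - (1-w)u) du` (differentiation under
the integral sign, dominated by `C u^{-1/2}` / `C` locally uniformly in `w`). [folklore] -/
theorem intervalIntegrable_scrVtxKernelDeriv_and_hasDerivAt_scrVtxAux (hk0 : 0 < k) (hk1 : k < 1) {w₀ : ℂ}
    (hw₀ : w₀ ∈ scrVtxDomain k) :
    IntervalIntegrable (scrVtxKernelDeriv k w₀) volume 0 1 ∧
      HasDerivAt (scrVtxAux k) (∫ u in (0 : ℝ)..1, scrVtxKernelDeriv k w₀ u) w₀ := by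
  obtain ⟨ε, hε, hball, C, -, hC⟩ := exists_bound_scrVtxKernel hk0 hk1 hw₀
  have hball' : ball w₀ ε ⊆ scrVtxDomain k := ball_subset_closedBall.trans hball
  exact intervalIntegral.hasDerivAt_integral_of_dominated_loc_of_deriv_le
    (μ := volume) (a := (0 : ℝ)) (b := 1) (F := scrVtxKernel k) (F' := scrVtxKernelDeriv k) (x₀ := w₀)
    (s := ball w₀ ε) (bound := fun _ => C)
    (ball_mem_nhds w₀ hε)
    (by filter_upwards [ball_mem_nhds w₀ hε] with w hw using aestronglyMeasurable_scrVtxKernel hk0 hk1 (hball' hw))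
    (intervalIntegrable_scrVtxKernel hk0 hk1 hw₀) (aestronglyMeasurable_scrVtxKernelDeriv hk0 hk1 hw₀)
    (Eventually.of_forall fun u hu w hw => by
      rw [uIoc_of_le zero_le_one] at hu
      exact (hC w (ball_subset_closedBall hw) u hu).2)
    intervalIntegrable_const
    (Eventually.of_forall fun u hu w hw => by
      rw [uIoc_of_le zero_le_one] at hu
      exact hasDerivAt_scrVtxKernel hk0 hk1 (hball' hw) hu)

/-- The `w`-derivative of the kernel is integrable in `u ∈ [0, 1]`. [folklore] -/
theorem intervalIntegrable_scrVtxKernelDeriv (hk0 : 0 < k) (hk1 : k < 1) {w : ℂ} (hw : w ∈ scrVtxDomain k) :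
    IntervalIntegrable (scrVtxKernelDeriv k w) volume 0 1 :=
  (intervalIntegrable_scrVtxKernelDeriv_and_hasDerivAt_scrVtxAux hk0 hk1 hw).1

/-- `h₁′(w) = ∫₀¹ u^{1/2} g_k′(1 - (1-w)u) du` on `ℂ \ ((-∞,-1] ∪ [1/k,∞))`. [folklore] -/
theorem hasDerivAt_scrVtxAux (hk0 : 0 < k) (hk1 : k < 1) {w : ℂ} (hw : w ∈ scrVtxDomain k) :
    HasDerivAt (scrVtxAux k) (∫ u in (0 : ℝ)..1, scrVtxKernelDeriv k w u) w :=
  (intervalIntegrable_scrVtxKernelDeriv_and_hasDerivAt_scrVtxAux hk0 hk1 hw).2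

/-- `h₁` is continuous on `ℂ \ ((-∞,-1] ∪ [1/k,∞))` (in particular at `1` and on `(-1, 1/k)`). [folklore] -/
theorem continuousOn_scrVtxAux (hk0 : 0 < k) (hk1 : k < 1) : ContinuousOn (scrVtxAux k) (scrVtxDomain k) :=
  fun _ hw => (hasDerivAt_scrVtxAux hk0 hk1 hw).continuousAt.continuousWithinAt

/-! ### `G_k′ = -f_k`: integration by parts -/

/-- The primitive `P(u) = 2 u^{1/2} g_k(1 - (1-w)u)` in `u` of `kernel - 2(1-w) ∂_w kernel`. [folklore] -/
def scrVtxPrim (k : ℝ) (w : ℂ) (u : ℝ) : ℂ :=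
  2 * ((u ^ (1 / 2 : ℝ) : ℝ) : ℂ) * scrVtxFactor k (1 - (1 - w) * (u : ℂ))

/-- `∂P/∂u = u^{-1/2} g_k(·) - 2(1-w) u^{1/2} g_k′(·)` on `(0, 1)`. [folklore] -/
theorem hasDerivAt_scrVtxPrim (hk0 : 0 < k) (hk1 : k < 1) {w : ℂ} (hw : w ∈ scrVtxDomain k) {u : ℝ}
    (hu : u ∈ Ioo (0 : ℝ) 1) :
    HasDerivAt (scrVtxPrim k w) (scrVtxKernel k w u - 2 * (1 - w) * scrVtxKernelDeriv k w u) u := by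
  have hseg := segment_mem_scrVtxDomain hk0 hk1 hw ⟨hu.1.le, hu.2.le⟩
  have h1 : HasDerivAt (fun u : ℝ => (((u ^ (1 / 2 : ℝ)) : ℝ) : ℂ))
      ((((1 / 2 : ℝ) * u ^ ((1 / 2 : ℝ) - 1)) : ℝ) : ℂ) u :=
    (Real.hasDerivAt_rpow_const (Or.inl hu.1.ne')).ofReal_comp
  have hi : HasDerivAt (fun u : ℝ => 1 - (1 - w) * (u : ℂ)) (-(1 - w)) u := by
    have h0 : HasDerivAt (fun z : ℂ => 1 - (1 - w) * z) (-((1 - w) * 1)) (u : ℂ) :=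
      ((hasDerivAt_id (u : ℂ)).const_mul (1 - w)).const_sub 1
    simpa using h0.comp_ofReal
  have h2 : HasDerivAt (fun u : ℝ => scrVtxFactor k (1 - (1 - w) * (u : ℂ)))
      (deriv (scrVtxFactor k) (1 - (1 - w) * (u : ℂ)) * -(1 - w)) u := by
    have := (differentiableAt_scrVtxFactor hk0 hk1 hseg).hasDerivAt.comp u hi
    simpa [Function.comp_def] using this
  have h := (h1.mul h2).const_mul (2 : ℂ)
  have hfun : scrVtxPrim k w = fun u : ℝ =>
      2 * ((((u ^ (1 / 2 : ℝ)) : ℝ) : ℂ) * scrVtxFactor k (1 - (1 - w) * (u : ℂ))) := by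
    funext u; simp only [scrVtxPrim, mul_assoc]
  rw [hfun]
  refine h.congr_deriv ?_
  have e1 : (1 / 2 : ℝ) - 1 = -(1 / 2) := by norm_num
  have e2 : u ^ (1 / 2 : ℝ) = u ^ (-(1 / 2 : ℝ)) * u := by
    rw [← Real.rpow_add_one hu.1.ne']; norm_num
  rw [e1, scrVtxKernel, scrVtxKernelDeriv, e2]
  push_cast
  ring

/-- `P` is continuous on `[0, 1]`. [folklore] -/
theorem continuousOn_scrVtxPrim (hk0 : 0 < k) (hk1 : k < 1) {w : ℂ} (hw : w ∈ scrVtxDomain k) :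
    ContinuousOn (scrVtxPrim k w) (Icc 0 1) := by
  intro u hu
  refine ContinuousAt.continuousWithinAt ?_
  unfold scrVtxPrim
  refine ContinuousAt.mul (ContinuousAt.mul continuousAt_const ?_) ?_
  · exact Complex.continuous_ofReal.continuousAt.comp
      (Real.continuousAt_rpow_const _ _ (Or.inr (by norm_num)))
  · exact ContinuousAt.comp (f := fun u : ℝ => 1 - (1 - w) * (u : ℂ))
      ((continuousOn_scrVtxFactor hk0 hk1).continuousAt ((isOpen_scrVtxDomain k).mem_nhds
        (segment_mem_scrVtxDomain hk0 hk1 hw hu))) (by fun_prop)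

/-- **Integration by parts**: `h₁(w) - 2(1-w) h₁′(w) = 2 g_k(w)` on `ℂ \ ((-∞,-1] ∪ [1/k,∞))`. [folklore] -/
theorem scrVtxAux_sub_integral (hk0 : 0 < k) (hk1 : k < 1) {w : ℂ} (hw : w ∈ scrVtxDomain k) :
    scrVtxAux k w - 2 * (1 - w) * ∫ u in (0 : ℝ)..1, scrVtxKernelDeriv k w u = 2 * scrVtxFactor k w := by
  have hi1 := intervalIntegrable_scrVtxKernel hk0 hk1 hw
  have hi2 : IntervalIntegrable (fun u => 2 * (1 - w) * scrVtxKernelDeriv k w u) volume 0 1 :=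
    (intervalIntegrable_scrVtxKernelDeriv hk0 hk1 hw).const_mul _
  have hftc : ∫ u in (0 : ℝ)..1, (scrVtxKernel k w u - 2 * (1 - w) * scrVtxKernelDeriv k w u) =
      scrVtxPrim k w 1 - scrVtxPrim k w 0 :=
    intervalIntegral.integral_eq_sub_of_hasDerivAt_of_le zero_le_one (continuousOn_scrVtxPrim hk0 hk1 hw)
      (fun u hu => hasDerivAt_scrVtxPrim hk0 hk1 hw hu) (hi1.sub hi2)
  rw [intervalIntegral.integral_sub hi1 hi2, intervalIntegral.integral_const_mul] at hftc
  have h1 : scrVtxPrim k w 1 = 2 * scrVtxFactor k w := by simp [scrVtxPrim]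
  have h0 : scrVtxPrim k w 0 = 0 := by simp [scrVtxPrim]
  rw [h1, h0, sub_zero] at hftc
  rw [← hftc, scrVtxAux]

/-- **`G_k′ = -f_k` on the doubly slit plane** (`0 < k < 1`): the vertex representation is a
primitive of `-f_k` (Ahlfors (1979), Ch. 6 §2.2). [cite: AhlforsCA1979, Ch. 6 §2.2] -/
theorem hasDerivAt_scrG (hk0 : 0 < k) (hk1 : k < 1) {w : ℂ} (hw : w ∈ scrDomain) :
    HasDerivAt (scrG k) (-scrDeriv k w) w := by
  have hw' := scrDomain_subset_scrVtxDomain hk0 hk1 hw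
  have hsl := one_sub_mem_slitPlane_of_mem_scrDomain hw
  have hne : (1 : ℂ) - w ≠ 0 := slitPlane_ne_zero hsl
  have h1 : HasDerivAt (fun w : ℂ => (1 - w) ^ (1 / 2 : ℂ)) ((1 / 2 : ℂ) * (1 - w) ^ ((1 / 2 : ℂ) - 1) * -1) w := by
    have := ((hasDerivAt_id w).const_sub 1).cpow_const (c := (1 / 2 : ℂ)) hsl
    simpa using this
  have h := h1.mul (hasDerivAt_scrVtxAux hk0 hk1 hw')
  have hfun : scrG k = fun w : ℂ => (1 - w) ^ (1 / 2 : ℂ) * scrVtxAux k w := rfl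
  rw [hfun]
  refine h.congr_deriv ?_
  have e1 : (1 / 2 : ℂ) - 1 = -(1 / 2) := by norm_num
  have e2 : (1 - w) ^ (1 / 2 : ℂ) = (1 - w) ^ (-(1 / 2 : ℂ)) * (1 - w) := by
    conv_lhs => rw [show (1 / 2 : ℂ) = -(1 / 2) + 1 by norm_num, cpow_add _ _ hne, cpow_one]
  rw [e1, e2, scrDeriv_eq_cpow_mul_scrVtxFactor hw]
  have key := scrVtxAux_sub_integral hk0 hk1 hw'
  calc (1 / 2 : ℂ) * (1 - w) ^ (-(1 / 2 : ℂ)) * -1 * scrVtxAux k w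
        + (1 - w) ^ (-(1 / 2 : ℂ)) * (1 - w) * ∫ u in (0 : ℝ)..1, scrVtxKernelDeriv k w u
      = -(1 / 2 : ℂ) * (1 - w) ^ (-(1 / 2 : ℂ)) *
          (scrVtxAux k w - 2 * (1 - w) * ∫ u in (0 : ℝ)..1, scrVtxKernelDeriv k w u) := by ring
    _ = -((1 - w) ^ (-(1 / 2 : ℂ)) * scrVtxFactor k w) := by rw [key]; ring

/-! ### `F_k + G_k ≡ K(k²)` on the doubly slit plane -/

/-- The doubly slit plane is star-convex about `0`. [folklore] -/
theorem starConvex_scrDomain : StarConvex ℝ (0 : ℂ) scrDomain := by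
  intro w hw a b ha hb hab
  have hb1 : |b| ≤ 1 := by rw [abs_of_nonneg hb]; linarith
  have := ofReal_mul_mem_scrDomain hw hb1
  rw [smul_zero, zero_add, Complex.real_smul]
  exact this

/-- The doubly slit plane is preconnected. [folklore] -/
theorem isPreconnected_scrDomain : IsPreconnected scrDomain :=
  (starConvex_scrDomain.isPathConnected zero_mem_scrDomain).isConnected.isPreconnected

/-- `F_k + G_k` is constant on the doubly slit plane (zero derivative on a preconnected open set). [folklore] -/
theorem scrFun_add_scrG_eq_scrG_zero (hk0 : 0 < k) (hk1 : k < 1) {w : ℂ} (hw : w ∈ scrDomain) :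
    scrFun k w + scrG k w = scrG k 0 := by
  have hderiv : ∀ z ∈ scrDomain, HasDerivAt (fun z => scrFun k z + scrG k z) 0 z := by
    intro z hz
    have h := (hasDerivAt_scrFun hk0.le hk1.le hz).add (hasDerivAt_scrG hk0 hk1 hz)
    rwa [add_neg_cancel] at h
  have key := isOpen_scrDomain.is_const_of_deriv_eq_zero isPreconnected_scrDomain
    (fun z hz => (hderiv z hz).differentiableAt.differentiableWithinAt)
    (fun z hz => (hderiv z hz).deriv) hw zero_mem_scrDomain
  rw [key, scrFun_zero, zero_add]

/-- For real `u ∈ (0, 1)`, the kernel at `w = 0` is the real elliptic integrand at `1 - u`: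
`u^{-1/2} g_k(1 - u) = ellIntegrand (k²) (1 - u)`. [folklore] -/
theorem scrVtxKernel_zero (hk0 : 0 < k) (hk1 : k < 1) {u : ℝ} (hu : u ∈ Ioo (0 : ℝ) 1) :
    scrVtxKernel k 0 u = (ellIntegrand (k ^ 2) (1 - u) : ℝ) := by
  have hk : (1 : ℝ) < k⁻¹ := one_lt_inv_iff₀.2 ⟨hk0, hk1⟩
  have ht : 1 - u ∈ Ioo (-1 : ℝ) k⁻¹ := ⟨by linarith [hu.2], by linarith [hu.1]⟩
  have ht' : 1 - u ∈ Ioo (-1 : ℝ) 1 := ⟨by linarith [hu.2], by linarith [hu.1]⟩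
  rw [scrVtxKernel, sub_zero, one_mul, show (1 : ℂ) - (u : ℂ) = ((1 - u : ℝ) : ℂ) by push_cast; ring,
    scrVtxFactor_ofReal hk0 hk1 ht, ← ofReal_mul]
  congr 1
  rw [ellIntegrand_eq_rpow (by nlinarith) ht', mul_pow,
    show 1 - (1 - u) ^ 2 = u * (1 + (1 - u)) by ring, Real.mul_rpow hu.1.le (by linarith [hu.2])]
  ring

/-- `G_k(0) = h₁(0) = ∫₀¹ u^{-1/2} g_k(1-u) du = ∫₀¹ ellIntegrand (k²) = K(k²)`. [folklore] -/
theorem scrG_zero (hk0 : 0 < k) (hk1 : k < 1) : scrG k 0 = (ellipticK (k ^ 2) : ℂ) := by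
  rw [scrG, sub_zero, one_cpow, one_mul, scrVtxAux]
  have h : ∫ u in (0 : ℝ)..1, scrVtxKernel k 0 u = ∫ u in (0 : ℝ)..1, ((ellIntegrand (k ^ 2) (1 - u) : ℝ) : ℂ) :=
    intervalIntegral.integral_congr_Ioo_of_le zero_le_one fun u hu => scrVtxKernel_zero hk0 hk1 hu
  rw [h, intervalIntegral.integral_ofReal, ellipticK_eq]
  congr 1
  rw [intervalIntegral.integral_comp_sub_left (ellIntegrand (k ^ 2)) 1]
  norm_num

/-- **`F_k + G_k ≡ K(k²)` on the doubly slit plane** (`0 < k < 1`). [cite: AhlforsCA1979, Ch. 6 §2.2] -/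
theorem scrFun_add_scrG (hk0 : 0 < k) (hk1 : k < 1) {w : ℂ} (hw : w ∈ scrDomain) :
    scrFun k w + scrG k w = (ellipticK (k ^ 2) : ℂ) := by
  rw [scrFun_add_scrG_eq_scrG_zero hk0 hk1 hw, scrG_zero hk0 hk1]

/-- `F_k = K(k²) - G_k` on `ℍₒ`. [folklore] -/
theorem scrFun_eq_sub_scrG (hk0 : 0 < k) (hk1 : k < 1) {w : ℂ} (hw : w ∈ upperHalfPlaneSet) :
    scrFun k w = (ellipticK (k ^ 2) : ℂ) - scrG k w := by
  rw [← scrFun_add_scrG hk0 hk1 (upperHalfPlaneSet_subset_scrDomain hw)]; ring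

/-! ### The boundary value at the prevertex `1` -/

/-- `(1 - w)^{1/2} → 0` as `w → 1`. [folklore] -/
theorem tendsto_one_sub_cpow_half_one : Tendsto (fun w : ℂ => (1 - w) ^ (1 / 2 : ℂ)) (𝓝 1) (𝓝 0) := by
  have h1 : Tendsto (fun w : ℂ => 1 - w) (𝓝 1) (𝓝 0) := by
    have : Tendsto (fun w : ℂ => 1 - w) (𝓝 1) (𝓝 (1 - 1)) := (continuous_const.sub continuous_id).tendsto 1
    rwa [sub_self] at this
  have h2 : ContinuousAt (fun z : ℂ => z ^ (1 / 2 : ℂ)) 0 :=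
    continuousAt_cpow_const_of_re_pos (Or.inl le_rfl) (by norm_num)
  have h3 := h2.tendsto.comp h1
  rwa [Function.comp_def, zero_cpow (by norm_num : (1 / 2 : ℂ) ≠ 0)] at h3

/-- `G_k(w) → 0` as `w → 1` (`(1-w)^{1/2} → 0` and `h₁` is continuous at `1`). [folklore] -/
theorem tendsto_scrG_one (hk0 : 0 < k) (hk1 : k < 1) : Tendsto (scrG k) (𝓝 1) (𝓝 0) := by
  have h2 : ContinuousAt (scrVtxAux k) 1 :=
    (continuousOn_scrVtxAux hk0 hk1).continuousAt ((isOpen_scrVtxDomain k).mem_nhds (one_mem_scrVtxDomain hk0 hk1))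
  have h := tendsto_one_sub_cpow_half_one.mul h2.tendsto
  rwa [zero_mul] at h

/-- **The boundary value at the prevertex `1` is the corner `K(k²)`**: `F_k(w) → K(k²)` as `w → 1`
within `ℍₒ` (Bollobás–Riordan (2006), p. 185: the corner `+K(k²)` of the rectangle). [cite: BollobasRiordan2006, Ch. 7 §7.1 p. 185] -/
theorem tendsto_scrFun_one (hk0 : 0 < k) (hk1 : k < 1) :
    Tendsto (scrFun k) (𝓝[upperHalfPlaneSet] 1) (𝓝 (ellipticK (k ^ 2) : ℂ)) := by
  have h : Tendsto (fun w => (ellipticK (k ^ 2) : ℂ) - scrG k w) (𝓝[upperHalfPlaneSet] 1)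
      (𝓝 ((ellipticK (k ^ 2) : ℂ) - 0)) :=
    (tendsto_const_nhds.sub (tendsto_scrG_one hk0 hk1)).mono_left nhdsWithin_le_nhds
  rw [sub_zero] at h
  exact h.congr' (eventually_mem_nhdsWithin.mono fun w hw => (scrFun_eq_sub_scrG hk0 hk1 hw).symm)

/-! ### Boundary values on the right side `(1, 1/k)` -/

/-- The real integral `h₁(x) = ∫₀¹ u^{-1/2} g_k(1 + (x-1)u) du` for `x ∈ (1, 1/k)` (real values of
`scrVtxAux` on the right side). [folklore] -/
def scrVtxAuxReal (k x : ℝ) : ℝ :=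
  ∫ u in (0 : ℝ)..1, u ^ (-(1 / 2 : ℝ)) *
    ((1 + (1 + (x - 1) * u)) ^ (-(1 / 2 : ℝ)) * (1 - (k * (1 + (x - 1) * u)) ^ 2) ^ (-(1 / 2 : ℝ)))

/-- The **height coordinate** `V_k(x) = √(x-1) h₁(x)` of the boundary value `K(k²) + i V_k(x)` at a
point `x` of `(1, 1/k)` (informally `∫₁ˣ dt/√((t²-1)(1-k²t²))`; only `0 ≤ V_k ≤ K(1-k²)` is used,
see `RectangleSCSymmetry.scrV_le`). [cite: BollobasRiordan2006, Ch. 7 §7.1 p. 185] -/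
def scrV (k x : ℝ) : ℝ := Real.sqrt (x - 1) * scrVtxAuxReal k x

/-- For `x ∈ [1, 1/k)` and `u ∈ (0, 1]` the kernel at `w = x` is real:
`u^{-1/2} g_k(1 + (x-1)u)` with `1 + (x-1)u ∈ [1, x] ⊆ (-1, 1/k)`. [folklore] -/
theorem scrVtxKernel_ofReal (hk0 : 0 < k) (hk1 : k < 1) {x : ℝ} (hx : x ∈ Ico (1 : ℝ) k⁻¹) {u : ℝ}
    (hu : u ∈ Ioc (0 : ℝ) 1) :
    scrVtxKernel k x u = ((u ^ (-(1 / 2 : ℝ)) * ((1 + (1 + (x - 1) * u)) ^ (-(1 / 2 : ℝ)) *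
      (1 - (k * (1 + (x - 1) * u)) ^ 2) ^ (-(1 / 2 : ℝ))) : ℝ) : ℂ) := by
  have ht : 1 + (x - 1) * u ∈ Ioo (-1 : ℝ) k⁻¹ := by
    constructor
    · nlinarith [hx.1, hu.1]
    · nlinarith [hx.2, hu.2, hx.1, hu.1]
  rw [scrVtxKernel, show (1 : ℂ) - (1 - (x : ℂ)) * (u : ℂ) = ((1 + (x - 1) * u : ℝ) : ℂ) by push_cast; ring,
    scrVtxFactor_ofReal hk0 hk1 ht, ← ofReal_mul]

/-- `h₁(x)` is real for `x ∈ [1, 1/k)`: `scrVtxAux k x = scrVtxAuxReal k x`. [folklore] -/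
theorem scrVtxAux_ofReal (hk0 : 0 < k) (hk1 : k < 1) {x : ℝ} (hx : x ∈ Ico (1 : ℝ) k⁻¹) :
    scrVtxAux k x = (scrVtxAuxReal k x : ℂ) := by
  rw [scrVtxAux, scrVtxAuxReal, ← intervalIntegral.integral_ofReal]
  exact intervalIntegral.integral_congr_Ioo_of_le zero_le_one fun u hu =>
    scrVtxKernel_ofReal hk0 hk1 hx ⟨hu.1, hu.2.le⟩

/-- `h₁(x) > 0` for `x ∈ [1, 1/k)` (positive integrand). [folklore] -/
theorem scrVtxAuxReal_pos (hk0 : 0 < k) (hk1 : k < 1) {x : ℝ} (hx : x ∈ Ico (1 : ℝ) k⁻¹) :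
    0 < scrVtxAuxReal k x := by
  have hint : IntervalIntegrable (fun u : ℝ => u ^ (-(1 / 2 : ℝ)) *
      ((1 + (1 + (x - 1) * u)) ^ (-(1 / 2 : ℝ)) * (1 - (k * (1 + (x - 1) * u)) ^ 2) ^ (-(1 / 2 : ℝ))))
      volume 0 1 := by
    have h := intervalIntegrable_scrVtxKernel hk0 hk1 (ofReal_mem_scrVtxDomain ⟨by linarith [hx.1], hx.2⟩)
    have h' : IntervalIntegrable (fun u => (scrVtxKernel k x u).re) volume 0 1 := ⟨h.1.re, h.2.re⟩
    refine h'.congr fun u hu => ?_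
    rw [uIoc_of_le zero_le_one] at hu
    show (scrVtxKernel k x u).re = _
    rw [scrVtxKernel_ofReal hk0 hk1 hx hu, ofReal_re]
  refine intervalIntegral.intervalIntegral_pos_of_pos_on hint (fun u hu => ?_) zero_lt_one
  have ht : 1 + (x - 1) * u ∈ Ioo (-1 : ℝ) k⁻¹ := by
    constructor
    · nlinarith [hx.1, hu.1]
    · nlinarith [hx.2, hu.2, hx.1, hu.1]
  exact mul_pos (Real.rpow_pos_of_pos hu.1 _) (scrVtxFactor_ofReal_pos hk0 hk1 ht)

/-- `V_k(x) ≥ 0` on `[1, 1/k)`. [folklore] -/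
theorem scrV_nonneg (hk0 : 0 < k) (hk1 : k < 1) {x : ℝ} (hx : x ∈ Ico (1 : ℝ) k⁻¹) : 0 ≤ scrV k x :=
  mul_nonneg (Real.sqrt_nonneg _) (scrVtxAuxReal_pos hk0 hk1 hx).le

/-- `V_k(x) > 0` on `(1, 1/k)`. [folklore] -/
theorem scrV_pos (hk0 : 0 < k) (hk1 : k < 1) {x : ℝ} (hx : x ∈ Ioo (1 : ℝ) k⁻¹) : 0 < scrV k x :=
  mul_pos (Real.sqrt_pos.2 (by linarith [hx.1])) (scrVtxAuxReal_pos hk0 hk1 ⟨hx.1.le, hx.2⟩)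

/-- **The branch of `(1-w)^{1/2}` from inside `ℍₒ`**: as `w → x > 1` within `ℍₒ`, `1 - w` tends to the
negative number `1 - x` from the lower half-plane, so `(1 - w)^{1/2} → -i √(x-1)`. [folklore] -/
theorem tendsto_one_sub_cpow_half_of_one_lt {x : ℝ} (hx : 1 < x) :
    Tendsto (fun w : ℂ => (1 - w) ^ (1 / 2 : ℂ)) (𝓝[upperHalfPlaneSet] x)
      (𝓝 (-I * (Real.sqrt (x - 1) : ℂ))) := by
  have hz : ((1 - x : ℝ) : ℂ).re < 0 := by simp; linarith
  have hzi : ((1 - x : ℝ) : ℂ).im = 0 := by simp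
  -- `1 - w → 1 - x` within the lower half-plane
  have h1 : Tendsto (fun w : ℂ => 1 - w) (𝓝[upperHalfPlaneSet] x) (𝓝[{z : ℂ | z.im < 0}] ((1 - x : ℝ) : ℂ)) := by
    refine tendsto_nhdsWithin_of_tendsto_nhds_of_eventually_within _ ?_ ?_
    · have : Tendsto (fun w : ℂ => 1 - w) (𝓝 (x : ℂ)) (𝓝 (1 - x)) := (continuous_const.sub continuous_id).tendsto _
      rw [show ((1 - x : ℝ) : ℂ) = 1 - x by push_cast; ring]
      exact this.mono_left nhdsWithin_le_nhds
    · refine eventually_mem_nhdsWithin.mono fun w (hw : 0 < w.im) => ?_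
      show (1 - w).im < 0
      simpa using hw
  have h2 := (tendsto_log_nhdsWithin_im_neg_of_re_neg_of_im_zero hz hzi).comp h1
  -- exponentiate
  have h3 : Tendsto (fun w : ℂ => exp (log (1 - w) * (1 / 2 : ℂ))) (𝓝[upperHalfPlaneSet] x)
      (𝓝 (exp ((Real.log ‖((1 - x : ℝ) : ℂ)‖ - π * I) * (1 / 2 : ℂ)))) :=
    (continuous_exp.tendsto _).comp (h2.mul_const _)
  have hval : exp ((Real.log ‖((1 - x : ℝ) : ℂ)‖ - π * I) * (1 / 2 : ℂ)) = -I * (Real.sqrt (x - 1) : ℂ) := by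
    have hn : ‖((1 - x : ℝ) : ℂ)‖ = x - 1 := by
      rw [Complex.norm_real, Real.norm_eq_abs, abs_of_neg (by linarith)]; ring
    rw [hn, sub_mul, Complex.exp_sub, show (π : ℂ) * I * (1 / 2 : ℂ) = (π / 2 : ℂ) * I by ring,
      Complex.exp_pi_div_two_mul_I,
      show (Real.log (x - 1) : ℂ) * (1 / 2 : ℂ) = ((Real.log (x - 1) * (1 / 2) : ℝ) : ℂ) by push_cast; ring,
      ← ofReal_exp, ← Real.rpow_def_of_pos (by linarith : (0 : ℝ) < x - 1), ← Real.sqrt_eq_rpow, div_I]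
    ring
  rw [← hval]
  refine h3.congr' ?_
  refine eventually_mem_nhdsWithin.mono fun w (hw : 0 < w.im) => ?_
  have hne : (1 : ℂ) - w ≠ 0 := fun h => by
    have := congrArg Complex.im h; simp at this; exact hw.ne' this
  show cexp (log (1 - w) * (1 / 2 : ℂ)) = (1 - w) ^ (1 / 2 : ℂ)
  rw [cpow_def_of_ne_zero hne]

/-- **Boundary values on the right side.** For `x ∈ (1, 1/k)`: `F_k(w) → K(k²) + i V_k(x)` as
`w → x` within `ℍₒ` — a point of the side `re = K(k²)` of the rectangle
(Bollobás–Riordan (2006), p. 185). [cite: BollobasRiordan2006, Ch. 7 §7.1 p. 185] -/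
theorem tendsto_scrFun_of_mem_Ioo_one_inv (hk0 : 0 < k) (hk1 : k < 1) {x : ℝ} (hx : x ∈ Ioo (1 : ℝ) k⁻¹) :
    Tendsto (scrFun k) (𝓝[upperHalfPlaneSet] x)
      (𝓝 ((ellipticK (k ^ 2) : ℂ) + I * (scrV k x : ℂ))) := by
  have hxD : (x : ℂ) ∈ scrVtxDomain k := ofReal_mem_scrVtxDomain ⟨by linarith [hx.1], hx.2⟩
  have h1 : Tendsto (scrVtxAux k) (𝓝[upperHalfPlaneSet] x) (𝓝 (scrVtxAuxReal k x : ℂ)) := by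
    rw [← scrVtxAux_ofReal hk0 hk1 ⟨hx.1.le, hx.2⟩]
    exact ((continuousOn_scrVtxAux hk0 hk1).continuousAt ((isOpen_scrVtxDomain k).mem_nhds hxD)).tendsto.mono_left
      nhdsWithin_le_nhds
  have h2 := (tendsto_one_sub_cpow_half_of_one_lt hx.1).mul h1
  have h3 := tendsto_const_nhds (x := (ellipticK (k ^ 2) : ℂ)) |>.sub h2
  have hval : (ellipticK (k ^ 2) : ℂ) - -I * (Real.sqrt (x - 1) : ℂ) * (scrVtxAuxReal k x : ℂ) =
      (ellipticK (k ^ 2) : ℂ) + I * (scrV k x : ℂ) := by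
    rw [scrV]; push_cast; ring
  rw [← hval]
  refine h3.congr' (eventually_mem_nhdsWithin.mono fun w hw => ?_)
  rw [scrFun_eq_sub_scrG hk0 hk1 hw, scrG]

end Literature.Probability.RandomPlanarGeometry

end
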